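/-
Copyright: the b2b-balaban T⁴-continuum CRUX team, row NE7b owner lineage `t4-ne7b-p1` (gen 115). Project licence.
-/
import Summits.QuantumFields.BalabanUV.T4Continuum.Spine.NE7b.FibreInverseSupNorm

/-!
# COMBES–THOMAS ROWS OF THE ONE-SHOT CHART: for a coarse weight `ρ : ℤ^d → ℝ` 1-Lipschitz in the sup metric and a rate
# `0 ≤ μ` below the kernels' decay rates, the section `H`, the block propagator `G′`, the block average `Q′`, the fibre inverse
# `Γ = (1 − HQ′)G′` and the displayed inverse `T⁻¹(k, ψ) = Hk + Γψ` of the augmented Gaussian skeleton on `ℤ^d` are BOUNDED IN THE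
# WEIGHTED SUP NORMS `‖f‖_{μ,ρ} := sup_p e^{μρ(blk p)}|f(p)|` with ASE's constant `N_∞` read at the SHIFTED rates
# `δ_H − μ`, `δ_u∕4 − μ`; corollaries: the ENTRIES of `Γ` decay exponentially at the block scale, and the free chart's inverse is
# LOCALISED — data at coarse distance `≥ D` from `blk p` is read at `p` with weight `≤ N_μ e^{−μD}`
# (row NE7b, node U5c; the weighted-`ℓ^∞` twin of (46) ∕ (49) ∕ (51) the OWNER g114's HANDOFF-FINAL names as item (i); [folklore])

Cell `pub-balaban`, sub-cell `t4`, spine estimate NE7b (`T4WeightBudget.RelWeightBound`; the cell's OWN estimate — NOT PRINTED in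
[Bałaban 1983–89], NOT PROVED).  Crux-route work under `Spine/NE7b/` by the row OWNER (`t4-ne7b-p1` gen 115) under FREEZE (0)'s
crux-prover clause (FILING-CLAIM C-ne7bp1-g115-1); NOTHING of Bałaban's is named as a Lean object, valued or asserted; no
`T4Continuum/Support` leaf typed; no `def`, no notation; zero `sorry`.  Imports (BY NAME): the owner's (51) `…FibreInverseSupNorm`
(`abs_blockAvg_le`; through it (46) `…OneShotChartSupNorm` and (49) `…BlockPropagatorSupNorm`: `sum_block_abs_Gk_le`,
`summable_Gk_mul_of_bounded`, `supConstG_nonneg`), the β-team's `D1BFx/BlockColumnSupNorm` (`abs_kerH_le_sup`: the MESH-FREE entry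
bound `|H(p,y)| ≤ cHs·e^{−δ_H|blk p − y|_∞}`), the Literature columns `B5Hk103ScalarZd` (`Gk`, `kerH`, `summable_expX`, `tsum_expX_le`,
`summable_blocks`, `tsum_blocks`), `B5Hk165L2Zd` (`HBZd`), `B6QGQLower276` (`X`, `blk`, `B`, `mem_B`), `B4Sect5Proof` (`latticeConst`).

WHY (located).  The sup column (46)–(61) gives the SIZE of the background response `Dσ(w)` and of the fluctuation covariance
`C̃(w)` at the background ((60) v1.1, (61) v1.1); what a cluster ∕ localisation expansion at the next scale consumes is their DECAY —
that `(Dσ(w)v)(p)` reads `v` near `blk p` with exponentially small weights far away (the pricing desk, PRICING-NE7b v132 F784 (a):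
«decay, not size, is what (A1c)'s localisation consumes; (i) is the load-bearing next junction»).  The device is Combes–Thomas ∕
Agmon: conjugate by `e^{μρ}` with `ρ` 1-Lipschitz and read the same row sums at the shifted rate.  Every kernel of the skeleton is
already displayed with its exponential row structure in coarse units — `H` by `abs_kerH_le_sup`, `G′` by (49)'s `sum_block_abs_Gk_le`
(`Σ_{q ∈ B(y)}|G′(p,q)| ≤ A_G e^{−(δ_u∕4)|blk p − y|_∞}`), `Q′` and `P` block-local — so the conjugation costs exactly the shift of the
rate in `K_d`.  Block-constant weights (`ρ∘blk`) are the right class: they commute with `Q′` and `P` and preserve `ker Q′`, and decay AT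
THE BLOCK SCALE is what the next scale sees.  This file is the row algebra; the a-priori letter for the INTERACTING chart (the
owner's (63) `…SupBackgroundLocalisation`) reads it.

WHAT IS PROVED ([folklore]; `n : ℕ` = side − 1, `a > 0`, `d ≥ 3` where marked; a weight is `ρ : X d → ℝ` with
`ρ x − ρ y ≤ dist x y` (sup metric of `ℤ^d`, coarse units); `A_G := (cG0·cKL + cSplit)e^{2δ_u} + cFar e^{4δ_u}∕δ_u²`):
* §1 `exp_weight_exchange` (`0 ≤ μ`: `e^{μρ(x)}·e^{−b|x−y|}·e^{−μρ(y)} ≤ e^{−(b−μ)|x−y|}`), `abs_le_exp_neg_mul` (reading a weighted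
  bound as a pointwise one), `lipschitz_dist_left` ∕ `lipschitz_trunc_dist` (the two weights used in §5: `dist(·, c)` and
  `D − min(dist(·,c), D)` are admissible).
* §2 **`weighted_HBZd`** (`d ≥ 3`, `0 ≤ μ < δ_H`): `e^{μρ(blk p)}|(Hk)(p)| ≤ cHs·K_d(δ_H − μ)·R` whenever `e^{μρ(y)}|k(y)| ≤ R` — the
  section is bounded `ℓ^∞_{μ,ρ}(coarse) → ℓ^∞_{μ,ρ∘blk}(fine)`, constant `C_H(μ) := cHs·K_d(δ_H − μ)` (`= C_∞` at `μ = 0`).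
* §3 **`weighted_Gop`** (`d ≥ 3`, `0 ≤ μ < δ_u∕4`): `e^{μρ(blk p)}|(G′ψ)(p)| ≤ A_G·K_d(δ_u∕4 − μ)·R` for bounded `ψ` with
  `e^{μρ(blk q)}|ψ(q)| ≤ R` — constant `C_G(μ) := A_G·K_d(δ_u∕4 − μ)`.
* §4 `weighted_blockAvg` (every `d`, any `μ`, `ρ`): `e^{μρ(y)}|Q′f(y)| ≤ R` whenever `e^{μρ(blk q)}|f(q)| ≤ R` — block averaging is
  weight-neutral for block-constant weights.
* §5 **`weighted_fibreInverse_of_letters`** ∕ **`weighted_fibreInverse`** (`d ≥ 3`, `0 ≤ μ < min(δ_H, δ_u∕4)`): the displayed fibre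
  inverse `(Γψ)(p) = (G′ψ)(p) − (H(Q′G′ψ))(p)` of (51) ∕ ASE obeys `e^{μρ(blk p)}|(Γψ)(p)| ≤ C_G(μ)(1 + C_H(μ))·R`;
  **`weighted_augInverse`**: ASE's displayed `T⁻¹(k,ψ) = Hk + Γψ` obeys
  `e^{μρ(blk p)}|T⁻¹(k,ψ)(p)| ≤ C_H(μ)·R_k + C_G(μ)(1 + C_H(μ))·R_ψ` — ASE's `N_∞` with both rates shifted by `μ`.
* §6 corollaries with the two admissible weights: **`abs_fibreInverse_entry_le`** — the ENTRY `Γ(p, q₀) := (Γ𝟙_{q₀})(p)` has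
  `|Γ(p,q₀)| ≤ C_G(μ)(1 + C_H(μ))·e^{−μ|blk p − blk q₀|_∞}`; **`abs_augInverse_le_of_far`** — if `k` vanishes on the coarse ball
  `{y : |y − blk p| < D}` and `ψ` on the blocks over it, then `|T⁻¹(k,ψ)(p)| ≤ (C_H(μ)R_k + C_G(μ)(1 + C_H(μ))R_ψ)·e^{−μD}` — THE
  LOCALISATION LETTER of the free chart.

HONEST (what this is NOT).  Constants existential (through `cHs`, `cFar`, lit1's Green-function constants) and useless by value; the
admissible rate window `μ < min(δ_H, δ_u∕4)` is symbolic (`δ_H = min(δ_u, δ_inv)∕2` of pv23's columns) — no number is claimed.  Scalar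
`ℤ^d` skeleton (`U = 1`), whole lattice, not the torus (periodisation of weighted rows is (55)'s pattern, not done here), not the
covariant operators ((A3), NC-NE7b-α UNRULED); the INTERACTING chart's localisation is the sibling (63), not here; nothing of
Bałaban's (A1c) localisation expansion itself.  BY-NAME EFFECT ON THE WALL: NONE.  NE7b NOT PRINTED ∕ NOT PROVED; spine PROVED 0∕9;
rung (B)+1 on a FINITE torus — NOT infinite volume, NOT the mass gap, NOT Clay.  HONEST DEPENDENCY: continuum YM on T⁴ ⇐ BetaPertH ∧
nine spine estimates (0∕9 proved); BetaPertH ⇐ (D1) ∧ (D4) ∧ CAP+tail; G-an2-4 gates asym, D1 and NE2∕3∕4.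
-/

set_option autoImplicit false

namespace Summit.QuantumFields.BalabanUV.T4Continuum.NE7b.OneShotChartWeightedRows

open Literature.MathematicalPhysics.QuantumFieldTheory.Balaban1983to89
open B4Sect5Proof (latticeConst latticeConst_nonneg)
open B6QGQLower276 (X blk B mem_B sum_B_const)
open B6QGQDecay237 (deltaU deltaU_pos)
open B5Hk103ScalarZd (Gk kerH summable_expX tsum_expX_le deltaH deltaH_pos summable_blocks tsum_blocks)
open B5Hk165L2Zd (HBZd)
open Summit.QuantumFields.BalabanUV.Beta.D1BFx.BlockColumnSupNorm (cHs cHs_nonneg abs_kerH_le_sup)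
open Summit.QuantumFields.BalabanUV.Beta.D1BFx.PointColumnSplit (cKL cG0 cSplit)
open Summit.QuantumFields.BalabanUV.Beta.D1BFx.PointColumnDecay (cFar)
open BlockPropagatorSupNorm (sum_block_abs_Gk_le summable_Gk_mul_of_bounded supConstG_nonneg)
open FibreInverseSupNorm (abs_blockAvg_le)

variable {d : ℕ}

/-! ## §1. Weight algebra -/

/-- **The Combes–Thomas exchange**: for a weight with `ρ x − ρ y ≤ |x − y|` and `0 ≤ μ`,
`e^{μρ(x)}·(e^{−b|x−y|}·e^{−μρ(y)}) ≤ e^{−(b−μ)|x−y|}`. [folklore] -/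
theorem exp_weight_exchange {μ b : ℝ} (hμ : 0 ≤ μ) {ρ : X d → ℝ} (hρ : ∀ x y, ρ x - ρ y ≤ dist x y) (x y : X d) :
    Real.exp (μ * ρ x) * (Real.exp (-(b * dist x y)) * Real.exp (-(μ * ρ y))) ≤ Real.exp (-((b - μ) * dist x y)) := by
  rw [← Real.exp_add, ← Real.exp_add, Real.exp_le_exp]
  have h := mul_le_mul_of_nonneg_left (hρ x y) hμ
  nlinarith

/-- Reading a weighted bound pointwise: `e^{μρ(x)}|t| ≤ R` gives `|t| ≤ R·e^{−μρ(x)}`. [folklore] -/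
theorem abs_le_exp_neg_mul {μ : ℝ} {ρ : X d → ℝ} {t R : ℝ} (x : X d) (h : Real.exp (μ * ρ x) * |t| ≤ R) :
    |t| ≤ R * Real.exp (-(μ * ρ x)) := by
  have hE : 0 < Real.exp (μ * ρ x) := Real.exp_pos _
  rw [Real.exp_neg, ← div_eq_mul_inv, le_div_iff₀ hE, mul_comm]
  exact h

/-- A weighted bound forces `0 ≤ R`. [folklore] -/
theorem nonneg_of_weighted {μ : ℝ} {ρ : X d → ℝ} {f : X d → ℝ} {g : X d → X d} {R : ℝ}
    (h : ∀ x, Real.exp (μ * ρ (g x)) * |f x| ≤ R) : 0 ≤ R :=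
  (mul_nonneg (Real.exp_pos _).le (abs_nonneg _)).trans (h 0)

/-- The weight `ρ = dist(·, c)` is admissible: `|x − c| − |y − c| ≤ |x − y|`. [folklore] -/
theorem lipschitz_dist_left (c x y : X d) : dist x c - dist y c ≤ dist x y :=
  (le_abs_self _).trans (abs_dist_sub_le x y c)

/-- The truncated weight `ρ = D − min(|· − c|, D)` is admissible. [folklore] -/
theorem lipschitz_trunc_dist (c : X d) (D : ℝ) (x y : X d) :
    (D - min (dist x c) D) - (D - min (dist y c) D) ≤ dist x y := by
  have h := abs_dist_sub_le y x c
  have h1 : dist y c - dist x c ≤ dist x y := by rw [dist_comm x y]; exact (le_abs_self _).trans h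
  rcases le_total (dist x c) D with hx | hx <;> rcases le_total (dist y c) D with hy | hy
  · rw [min_eq_left hx, min_eq_left hy]; linarith
  · rw [min_eq_left hx, min_eq_right hy]; linarith
  · rw [min_eq_right hx, min_eq_left hy]; linarith [dist_nonneg (x := x) (y := y)]
  · rw [min_eq_right hx, min_eq_right hy]; linarith [dist_nonneg (x := x) (y := y)]

/-! ## §2. The section `H` in the weighted currency -/

/-- **THE WEIGHTED SECTION LETTER** (`d ≥ 3`, `0 ≤ μ < δ_H`): if `e^{μρ(y)}|k(y)| ≤ R` for every coarse `y`, then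
`e^{μρ(blk p)}|(Hk)(p)| ≤ cHs·K_d(δ_H − μ)·R` for every fine `p` — `‖H‖ ≤ C_H(μ)` between the weighted sup spaces, every side.
(No separate boundedness of `k` is needed: the weighted bound is the summable majorant.) [folklore] -/
theorem weighted_HBZd (hd : 3 ≤ d) (n : ℕ) {a : ℝ} (ha : 0 < a) {μ : ℝ} (hμ0 : 0 ≤ μ) (hμ : μ < deltaH d a)
    {ρ : X d → ℝ} (hρ : ∀ x y, ρ x - ρ y ≤ dist x y) {k : X d → ℝ} {R : ℝ}
    (hk : ∀ y, Real.exp (μ * ρ y) * |k y| ≤ R) (p : X d) :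
    Real.exp (μ * ρ (blk n p)) * |HBZd n a k p| ≤ cHs d a * latticeConst d (deltaH d a - μ) * R := by
  have hR : 0 ≤ R := nonneg_of_weighted (g := id) hk
  have hb : 0 < deltaH d a - μ := sub_pos.2 hμ
  have hE : 0 < Real.exp (μ * ρ (blk n p)) := Real.exp_pos _
  -- majorant `y ↦ cHs·R·e^{−μρ(blk p)}·e^{−(δ_H − μ)|blk p − y|}`
  have hmaj : Summable fun y : X d =>
      cHs d a * R * Real.exp (-(μ * ρ (blk n p))) * Real.exp (-((deltaH d a - μ) * dist (blk n p) y)) :=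
    (summable_expX hb (blk n p)).mul_left _
  have hpt : ∀ y : X d, ‖k y * kerH n a p y‖
      ≤ cHs d a * R * Real.exp (-(μ * ρ (blk n p))) * Real.exp (-((deltaH d a - μ) * dist (blk n p) y)) := by
    intro y
    rw [Real.norm_eq_abs, abs_mul]
    have h1 := abs_le_exp_neg_mul y (hk y)
    have h2 := abs_kerH_le_sup hd n ha p y
    have h3 := exp_weight_exchange (b := deltaH d a) hμ0 hρ (blk n p) y
    have hc := cHs_nonneg d ha
    calc |k y| * |kerH n a p y|
        ≤ (R * Real.exp (-(μ * ρ y))) * (cHs d a * Real.exp (-(deltaH d a * dist (blk n p) y))) :=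
          mul_le_mul h1 h2 (abs_nonneg _) (by positivity)
      _ = cHs d a * R * Real.exp (-(μ * ρ (blk n p)))
            * (Real.exp (μ * ρ (blk n p)) * (Real.exp (-(deltaH d a * dist (blk n p) y)) * Real.exp (-(μ * ρ y)))) := by
          have : Real.exp (-(μ * ρ (blk n p))) * Real.exp (μ * ρ (blk n p)) = 1 := by
            rw [← Real.exp_add, neg_add_cancel, Real.exp_zero]
          calc (R * Real.exp (-(μ * ρ y))) * (cHs d a * Real.exp (-(deltaH d a * dist (blk n p) y)))
              = cHs d a * R * 1 * (Real.exp (-(deltaH d a * dist (blk n p) y)) * Real.exp (-(μ * ρ y))) := by ring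
            _ = _ := by rw [← this]; ring
      _ ≤ cHs d a * R * Real.exp (-(μ * ρ (blk n p))) * Real.exp (-((deltaH d a - μ) * dist (blk n p) y)) :=
          mul_le_mul_of_nonneg_left h3 (by positivity)
  have h := tsum_of_norm_bounded hmaj.hasSum hpt
  rw [Real.norm_eq_abs, tsum_mul_left] at h
  have hK := tsum_expX_le hb (blk n p)
  have hc := cHs_nonneg d ha
  calc Real.exp (μ * ρ (blk n p)) * |HBZd n a k p|
      = Real.exp (μ * ρ (blk n p)) * |∑' y : X d, k y * kerH n a p y| := by rw [HBZd]
    _ ≤ Real.exp (μ * ρ (blk n p)) * (cHs d a * R * Real.exp (-(μ * ρ (blk n p)))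
          * ∑' y : X d, Real.exp (-((deltaH d a - μ) * dist (blk n p) y))) := mul_le_mul_of_nonneg_left h hE.le
    _ = cHs d a * R * ∑' y : X d, Real.exp (-((deltaH d a - μ) * dist (blk n p) y)) := by
          have : Real.exp (μ * ρ (blk n p)) * Real.exp (-(μ * ρ (blk n p))) = 1 := by
            rw [← Real.exp_add, add_neg_cancel, Real.exp_zero]
          calc _ = (Real.exp (μ * ρ (blk n p)) * Real.exp (-(μ * ρ (blk n p)))) * (cHs d a * R)
                * ∑' y : X d, Real.exp (-((deltaH d a - μ) * dist (blk n p) y)) := by ring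
            _ = _ := by rw [this, one_mul]
    _ ≤ cHs d a * R * latticeConst d (deltaH d a - μ) := mul_le_mul_of_nonneg_left hK (by positivity)
    _ = cHs d a * latticeConst d (deltaH d a - μ) * R := by ring

/-! ## §3. The block propagator `G′` in the weighted currency -/

/-- One block of the weighted row of `G′` (`d ≥ 3`, `0 ≤ μ`): for bounded-on-the-block data with `e^{μρ(blk q)}|ψ(q)| ≤ R`,
`|Σ_{q ∈ B(y)} G′(p,q)ψ(q)| ≤ A_G·R·e^{−μρ(blk p)}·e^{−(δ_u∕4 − μ)|blk p − y|}`. [folklore] -/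
theorem abs_sum_block_Gk_mul_le (hd : 3 ≤ d) (n : ℕ) {a : ℝ} (ha : 0 < a) {μ : ℝ} (hμ0 : 0 ≤ μ)
    {ρ : X d → ℝ} (hρ : ∀ x y, ρ x - ρ y ≤ dist x y) {ψ : X d → ℝ} {R : ℝ}
    (hψ : ∀ q, Real.exp (μ * ρ (blk n q)) * |ψ q| ≤ R) (p y : X d) :
    |∑ q ∈ B n y, Gk n a p q * ψ q|
      ≤ ((cG0 d * cKL d (d - 2) + cSplit d a) * Real.exp (2 * deltaU d a)
            + cFar d a * Real.exp (4 * deltaU d a) / deltaU d a ^ 2) * R * Real.exp (-(μ * ρ (blk n p)))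
          * Real.exp (-((deltaU d a / 4 - μ) * dist (blk n p) y)) := by
  have hR : 0 ≤ R := nonneg_of_weighted hψ
  have hA := supConstG_nonneg d ha
  have hblk : ∀ q ∈ B n y, |ψ q| ≤ R * Real.exp (-(μ * ρ y)) := fun q hq => by
    have h := abs_le_exp_neg_mul (ρ := ρ) (blk n q) (hψ q)
    rwa [mem_B.1 hq] at h
  have h3 := exp_weight_exchange (b := deltaU d a / 4) hμ0 hρ (blk n p) y
  calc |∑ q ∈ B n y, Gk n a p q * ψ q| ≤ ∑ q ∈ B n y, |Gk n a p q * ψ q| := Finset.abs_sum_le_sum_abs _ _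
    _ ≤ ∑ q ∈ B n y, |Gk n a p q| * (R * Real.exp (-(μ * ρ y))) := Finset.sum_le_sum fun q hq => by
        rw [abs_mul]; exact mul_le_mul_of_nonneg_left (hblk q hq) (abs_nonneg _)
    _ = (∑ q ∈ B n y, |Gk n a p q|) * (R * Real.exp (-(μ * ρ y))) := by rw [Finset.sum_mul]
    _ ≤ (((cG0 d * cKL d (d - 2) + cSplit d a) * Real.exp (2 * deltaU d a)
            + cFar d a * Real.exp (4 * deltaU d a) / deltaU d a ^ 2)
          * Real.exp (-(deltaU d a / 4 * dist (blk n p) y))) * (R * Real.exp (-(μ * ρ y))) :=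
        mul_le_mul_of_nonneg_right (sum_block_abs_Gk_le hd n ha p y) (by positivity)
    _ = ((cG0 d * cKL d (d - 2) + cSplit d a) * Real.exp (2 * deltaU d a)
            + cFar d a * Real.exp (4 * deltaU d a) / deltaU d a ^ 2) * R * Real.exp (-(μ * ρ (blk n p)))
          * (Real.exp (μ * ρ (blk n p)) * (Real.exp (-(deltaU d a / 4 * dist (blk n p) y)) * Real.exp (-(μ * ρ y)))) := by
        have : Real.exp (-(μ * ρ (blk n p))) * Real.exp (μ * ρ (blk n p)) = 1 := by
          rw [← Real.exp_add, neg_add_cancel, Real.exp_zero]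
        calc _ = ((cG0 d * cKL d (d - 2) + cSplit d a) * Real.exp (2 * deltaU d a)
              + cFar d a * Real.exp (4 * deltaU d a) / deltaU d a ^ 2) * R * 1
              * (Real.exp (-(deltaU d a / 4 * dist (blk n p) y)) * Real.exp (-(μ * ρ y))) := by ring
          _ = _ := by rw [← this]; ring
    _ ≤ _ := mul_le_mul_of_nonneg_left h3 (by positivity)

/-- **THE WEIGHTED PROPAGATOR LETTER** (`d ≥ 3`, `0 ≤ μ < δ_u∕4`): for bounded `ψ` with `e^{μρ(blk q)}|ψ(q)| ≤ R`,
`e^{μρ(blk p)}|(G′ψ)(p)| ≤ A_G·K_d(δ_u∕4 − μ)·R` for every `p` — `‖G′‖ ≤ C_G(μ)` on the weighted sup space, every side. [folklore] -/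
theorem weighted_Gop (hd : 3 ≤ d) (n : ℕ) {a : ℝ} (ha : 0 < a) {μ : ℝ} (hμ0 : 0 ≤ μ) (hμ : μ < deltaU d a / 4)
    {ρ : X d → ℝ} (hρ : ∀ x y, ρ x - ρ y ≤ dist x y) {ψ : X d → ℝ} {R R' : ℝ} (hψb : ∀ q, |ψ q| ≤ R')
    (hψ : ∀ q, Real.exp (μ * ρ (blk n q)) * |ψ q| ≤ R) (p : X d) :
    Real.exp (μ * ρ (blk n p)) * |∑' q : X d, Gk n a p q * ψ q|
      ≤ ((cG0 d * cKL d (d - 2) + cSplit d a) * Real.exp (2 * deltaU d a)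
            + cFar d a * Real.exp (4 * deltaU d a) / deltaU d a ^ 2) * latticeConst d (deltaU d a / 4 - μ) * R := by
  have hR : 0 ≤ R := nonneg_of_weighted hψ
  have hA := supConstG_nonneg d ha
  have hb : 0 < deltaU d a / 4 - μ := sub_pos.2 hμ
  have hE : 0 < Real.exp (μ * ρ (blk n p)) := Real.exp_pos _
  have hs : Summable fun q : X d => Gk n a p q * ψ q := summable_Gk_mul_of_bounded n ha hψb p
  rw [← tsum_blocks n hs]
  have hmaj : Summable fun y : X d =>
      ((cG0 d * cKL d (d - 2) + cSplit d a) * Real.exp (2 * deltaU d a)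
            + cFar d a * Real.exp (4 * deltaU d a) / deltaU d a ^ 2) * R * Real.exp (-(μ * ρ (blk n p)))
          * Real.exp (-((deltaU d a / 4 - μ) * dist (blk n p) y)) :=
    (summable_expX hb (blk n p)).mul_left _
  have h := tsum_of_norm_bounded hmaj.hasSum fun y => by
    rw [Real.norm_eq_abs]; exact abs_sum_block_Gk_mul_le hd n ha hμ0 hρ hψ p y
  rw [Real.norm_eq_abs, tsum_mul_left] at h
  have hK := tsum_expX_le hb (blk n p)
  calc Real.exp (μ * ρ (blk n p)) * |∑' y : X d, ∑ q ∈ B n y, Gk n a p q * ψ q|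
      ≤ Real.exp (μ * ρ (blk n p)) * (((cG0 d * cKL d (d - 2) + cSplit d a) * Real.exp (2 * deltaU d a)
            + cFar d a * Real.exp (4 * deltaU d a) / deltaU d a ^ 2) * R * Real.exp (-(μ * ρ (blk n p)))
          * ∑' y : X d, Real.exp (-((deltaU d a / 4 - μ) * dist (blk n p) y))) := mul_le_mul_of_nonneg_left h hE.le
    _ = ((cG0 d * cKL d (d - 2) + cSplit d a) * Real.exp (2 * deltaU d a)
            + cFar d a * Real.exp (4 * deltaU d a) / deltaU d a ^ 2) * R
          * ∑' y : X d, Real.exp (-((deltaU d a / 4 - μ) * dist (blk n p) y)) := by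
        have : Real.exp (μ * ρ (blk n p)) * Real.exp (-(μ * ρ (blk n p))) = 1 := by
          rw [← Real.exp_add, add_neg_cancel, Real.exp_zero]
        calc _ = (Real.exp (μ * ρ (blk n p)) * Real.exp (-(μ * ρ (blk n p))))
              * (((cG0 d * cKL d (d - 2) + cSplit d a) * Real.exp (2 * deltaU d a)
                  + cFar d a * Real.exp (4 * deltaU d a) / deltaU d a ^ 2) * R)
              * ∑' y : X d, Real.exp (-((deltaU d a / 4 - μ) * dist (blk n p) y)) := by ring
          _ = _ := by rw [this, one_mul]
    _ ≤ ((cG0 d * cKL d (d - 2) + cSplit d a) * Real.exp (2 * deltaU d a)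
            + cFar d a * Real.exp (4 * deltaU d a) / deltaU d a ^ 2) * R * latticeConst d (deltaU d a / 4 - μ) :=
        mul_le_mul_of_nonneg_left hK (by positivity)
    _ = _ := by ring

/-! ## §4. The block average is weight-neutral -/

/-- **Block averaging is weight-neutral** (every `d`, any `μ`, `ρ`): if `e^{μρ(blk q)}|f(q)| ≤ R` then
`e^{μρ(y)}|Q′f(y)| ≤ R`, `Q′f(y) = |B|⁻¹Σ_{q ∈ B(y)} f(q)` — on the block `B(y)` the weight IS `e^{μρ(y)}`. [folklore] -/
theorem weighted_blockAvg (n : ℕ) {μ : ℝ} {ρ : X d → ℝ} {f : X d → ℝ} {R : ℝ}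
    (hf : ∀ q, Real.exp (μ * ρ (blk n q)) * |f q| ≤ R) (y : X d) :
    Real.exp (μ * ρ y) * |(((n : ℝ) + 1) ^ d)⁻¹ * ∑ q ∈ B n y, f q| ≤ R := by
  have hg : ∀ q, |Real.exp (μ * ρ (blk n q)) * f q| ≤ R := fun q => by
    rw [abs_mul, abs_of_pos (Real.exp_pos _)]; exact hf q
  have h := abs_blockAvg_le n hg y
  have hsum : ∑ q ∈ B n y, Real.exp (μ * ρ (blk n q)) * f q = Real.exp (μ * ρ y) * ∑ q ∈ B n y, f q := by
    rw [Finset.mul_sum]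
    exact Finset.sum_congr rfl fun q hq => by rw [mem_B.1 hq]
  rw [hsum, mul_left_comm] at h
  rwa [← abs_of_pos (Real.exp_pos (μ * ρ y)), ← abs_mul]

/-! ## §5. The fibre inverse `Γ` and the augmented inverse `T⁻¹` in the weighted currency -/

/-- **THE WEIGHTED FIBRE-INVERSE LETTER, from letters**: if `H` is `C_H`-bounded between the weighted sup spaces and `G′ψ` has
weighted size `≤ C_G·R`, then the displayed `(Γψ)(p) = (G′ψ)(p) − (H(Q′G′ψ))(p)` has `e^{μρ(blk p)}|(Γψ)(p)| ≤ C_G(1 + C_H)R`.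
[folklore] -/
theorem weighted_fibreInverse_of_letters (n : ℕ) {a μ : ℝ} {ρ : X d → ℝ} {ψ : X d → ℝ} {R C_G C_H : ℝ}
    (hH : ∀ (k : X d → ℝ) (R' : ℝ), (∀ y, Real.exp (μ * ρ y) * |k y| ≤ R') →
      ∀ p, Real.exp (μ * ρ (blk n p)) * |HBZd n a k p| ≤ C_H * R')
    (hG : ∀ p, Real.exp (μ * ρ (blk n p)) * |∑' q : X d, Gk n a p q * ψ q| ≤ C_G * R) (p : X d) :
    Real.exp (μ * ρ (blk n p)) *
        |(∑' q : X d, Gk n a p q * ψ q)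
          - HBZd n a (fun y => (((n : ℝ) + 1) ^ d)⁻¹ * ∑ p' ∈ B n y, ∑' q : X d, Gk n a p' q * ψ q) p|
      ≤ C_G * (1 + C_H) * R := by
  have h1 := hG p
  have hQ : ∀ y, Real.exp (μ * ρ y) * |(((n : ℝ) + 1) ^ d)⁻¹ * ∑ p' ∈ B n y, ∑' q : X d, Gk n a p' q * ψ q| ≤ C_G * R :=
    weighted_blockAvg n hG
  have h2 := hH _ _ hQ p
  have hE : 0 ≤ Real.exp (μ * ρ (blk n p)) := (Real.exp_pos _).le
  calc _ ≤ Real.exp (μ * ρ (blk n p)) * (|∑' q : X d, Gk n a p q * ψ q|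
          + |HBZd n a (fun y => (((n : ℝ) + 1) ^ d)⁻¹ * ∑ p' ∈ B n y, ∑' q : X d, Gk n a p' q * ψ q) p|) :=
        mul_le_mul_of_nonneg_left (abs_sub _ _) hE
    _ ≤ C_G * R + C_H * (C_G * R) := by rw [mul_add]; exact add_le_add h1 h2
    _ = C_G * (1 + C_H) * R := by ring

/-- **THE WEIGHTED FIBRE-INVERSE LETTER** (`d ≥ 3`, `0 ≤ μ < δ_H`, `μ < δ_u∕4`): for bounded `ψ` with `e^{μρ(blk q)}|ψ(q)| ≤ R`,
`e^{μρ(blk p)}|(Γψ)(p)| ≤ A_G K_d(δ_u∕4 − μ)·(1 + cHs K_d(δ_H − μ))·R` — (51)'s constant at the shifted rates. [folklore] -/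
theorem weighted_fibreInverse (hd : 3 ≤ d) (n : ℕ) {a : ℝ} (ha : 0 < a) {μ : ℝ} (hμ0 : 0 ≤ μ) (hμH : μ < deltaH d a)
    (hμU : μ < deltaU d a / 4) {ρ : X d → ℝ} (hρ : ∀ x y, ρ x - ρ y ≤ dist x y) {ψ : X d → ℝ} {R R' : ℝ}
    (hψb : ∀ q, |ψ q| ≤ R') (hψ : ∀ q, Real.exp (μ * ρ (blk n q)) * |ψ q| ≤ R) (p : X d) :
    Real.exp (μ * ρ (blk n p)) *
        |(∑' q : X d, Gk n a p q * ψ q)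
          - HBZd n a (fun y => (((n : ℝ) + 1) ^ d)⁻¹ * ∑ p' ∈ B n y, ∑' q : X d, Gk n a p' q * ψ q) p|
      ≤ ((cG0 d * cKL d (d - 2) + cSplit d a) * Real.exp (2 * deltaU d a)
            + cFar d a * Real.exp (4 * deltaU d a) / deltaU d a ^ 2) * latticeConst d (deltaU d a / 4 - μ)
          * (1 + cHs d a * latticeConst d (deltaH d a - μ)) * R :=
  weighted_fibreInverse_of_letters n (fun _ _ hk q => weighted_HBZd hd n ha hμ0 hμH hρ hk q) (fun q => weighted_Gop hd n ha hμ0 hμU hρ hψb hψ q) p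

/-- **THE WEIGHTED LETTER FOR THE AUGMENTED INVERSE** (`d ≥ 3`, `0 ≤ μ < δ_H`, `μ < δ_u∕4`): ASE's displayed
`T⁻¹(k, ψ)(p) = (Hk)(p) + (Γψ)(p)` obeys `e^{μρ(blk p)}|T⁻¹(k,ψ)(p)| ≤ C_H(μ)·R_k + C_G(μ)(1 + C_H(μ))·R_ψ` whenever
`e^{μρ(y)}|k(y)| ≤ R_k` and `e^{μρ(blk q)}|ψ(q)| ≤ R_ψ` (`ψ` bounded) — ASE's `N_∞` with both rates shifted by `μ`. [folklore] -/
theorem weighted_augInverse (hd : 3 ≤ d) (n : ℕ) {a : ℝ} (ha : 0 < a) {μ : ℝ} (hμ0 : 0 ≤ μ) (hμH : μ < deltaH d a)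
    (hμU : μ < deltaU d a / 4) {ρ : X d → ℝ} (hρ : ∀ x y, ρ x - ρ y ≤ dist x y) {k ψ : X d → ℝ} {Rk Rψ R' : ℝ}
    (hk : ∀ y, Real.exp (μ * ρ y) * |k y| ≤ Rk) (hψb : ∀ q, |ψ q| ≤ R')
    (hψ : ∀ q, Real.exp (μ * ρ (blk n q)) * |ψ q| ≤ Rψ) (p : X d) :
    Real.exp (μ * ρ (blk n p)) *
        |HBZd n a k p + ((∑' q : X d, Gk n a p q * ψ q)
          - HBZd n a (fun y => (((n : ℝ) + 1) ^ d)⁻¹ * ∑ p' ∈ B n y, ∑' q : X d, Gk n a p' q * ψ q) p)|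
      ≤ cHs d a * latticeConst d (deltaH d a - μ) * Rk
        + ((cG0 d * cKL d (d - 2) + cSplit d a) * Real.exp (2 * deltaU d a)
              + cFar d a * Real.exp (4 * deltaU d a) / deltaU d a ^ 2) * latticeConst d (deltaU d a / 4 - μ)
            * (1 + cHs d a * latticeConst d (deltaH d a - μ)) * Rψ := by
  have h1 := weighted_HBZd hd n ha hμ0 hμH hρ hk p
  have h2 := weighted_fibreInverse hd n ha hμ0 hμH hμU hρ hψb hψ p
  have hE : 0 ≤ Real.exp (μ * ρ (blk n p)) := (Real.exp_pos _).le
  calc _ ≤ Real.exp (μ * ρ (blk n p)) * (|HBZd n a k p| + |(∑' q : X d, Gk n a p q * ψ q)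
          - HBZd n a (fun y => (((n : ℝ) + 1) ^ d)⁻¹ * ∑ p' ∈ B n y, ∑' q : X d, Gk n a p' q * ψ q) p|) :=
        mul_le_mul_of_nonneg_left (abs_add_le _ _) hE
    _ ≤ _ := by rw [mul_add]; exact add_le_add h1 h2

/-! ## §6. Corollaries: decay of the fibre inverse's entries; the localisation letter of the free chart -/

/-- **EXPONENTIAL DECAY OF THE FIBRE INVERSE's ENTRIES AT THE BLOCK SCALE** (`d ≥ 3`, `0 ≤ μ < δ_H`, `μ < δ_u∕4`): the entry
`Γ(p, q₀) := (Γ𝟙_{q₀})(p)` of the displayed fibre inverse has `|Γ(p,q₀)| ≤ C_G(μ)(1 + C_H(μ))·e^{−μ|blk p − blk q₀|_∞}` — the weight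
`ρ = dist(·, blk q₀)`. [folklore] -/
theorem abs_fibreInverse_entry_le (hd : 3 ≤ d) (n : ℕ) {a : ℝ} (ha : 0 < a) {μ : ℝ} (hμ0 : 0 ≤ μ) (hμH : μ < deltaH d a)
    (hμU : μ < deltaU d a / 4) (p q₀ : X d) :
    |(∑' q : X d, Gk n a p q * (if q = q₀ then (1 : ℝ) else 0))
          - HBZd n a (fun y => (((n : ℝ) + 1) ^ d)⁻¹ * ∑ p' ∈ B n y,
              ∑' q : X d, Gk n a p' q * (if q = q₀ then (1 : ℝ) else 0)) p|
      ≤ ((cG0 d * cKL d (d - 2) + cSplit d a) * Real.exp (2 * deltaU d a)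
            + cFar d a * Real.exp (4 * deltaU d a) / deltaU d a ^ 2) * latticeConst d (deltaU d a / 4 - μ)
          * (1 + cHs d a * latticeConst d (deltaH d a - μ)) * Real.exp (-(μ * dist (blk n p) (blk n q₀))) := by
  have hρ : ∀ x y : X d, dist x (blk n q₀) - dist y (blk n q₀) ≤ dist x y := lipschitz_dist_left (blk n q₀)
  have hψb : ∀ q : X d, |(if q = q₀ then (1 : ℝ) else 0)| ≤ 1 := fun q => by split_ifs <;> simp
  have hψ : ∀ q : X d, Real.exp (μ * dist (blk n q) (blk n q₀)) * |(if q = q₀ then (1 : ℝ) else 0)| ≤ 1 := fun q => by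
    split_ifs with h
    · rw [h, dist_self, mul_zero, Real.exp_zero, abs_one, mul_one]
    · rw [abs_zero, mul_zero]; exact zero_le_one
  have h := weighted_fibreInverse hd n ha hμ0 hμH hμU hρ hψb hψ p
  rw [mul_one] at h
  have h' := abs_le_exp_neg_mul (μ := μ) (ρ := fun x => dist x (blk n q₀)) (blk n p) h
  exact h'

/-- **THE LOCALISATION LETTER OF THE FREE CHART** (`d ≥ 3`, `0 ≤ μ < δ_H`, `μ < δ_u∕4`): if the coarse datum `k` (`|k| ≤ R_k`)
vanishes on the coarse ball `{y : |y − blk p| < D}` and the fibre datum `ψ` (`|ψ| ≤ R_ψ`) vanishes on the blocks over it, then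
`|T⁻¹(k,ψ)(p)| ≤ (C_H(μ)R_k + C_G(μ)(1 + C_H(μ))R_ψ)·e^{−μD}` — the value of the free background at `p` reads far data with
exponentially small weight; the weight `ρ = D − min(|· − blk p|, D)`. [folklore] -/
theorem abs_augInverse_le_of_far (hd : 3 ≤ d) (n : ℕ) {a : ℝ} (ha : 0 < a) {μ : ℝ} (hμ0 : 0 ≤ μ) (hμH : μ < deltaH d a)
    (hμU : μ < deltaU d a / 4) {k ψ : X d → ℝ} {Rk Rψ D : ℝ} (hk : ∀ y, |k y| ≤ Rk) (hψ : ∀ q, |ψ q| ≤ Rψ) (p : X d)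
    (hkfar : ∀ y, dist y (blk n p) < D → k y = 0) (hψfar : ∀ q, dist (blk n q) (blk n p) < D → ψ q = 0) :
    |HBZd n a k p + ((∑' q : X d, Gk n a p q * ψ q)
          - HBZd n a (fun y => (((n : ℝ) + 1) ^ d)⁻¹ * ∑ p' ∈ B n y, ∑' q : X d, Gk n a p' q * ψ q) p)|
      ≤ (cHs d a * latticeConst d (deltaH d a - μ) * Rk
          + ((cG0 d * cKL d (d - 2) + cSplit d a) * Real.exp (2 * deltaU d a)
                + cFar d a * Real.exp (4 * deltaU d a) / deltaU d a ^ 2) * latticeConst d (deltaU d a / 4 - μ)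
              * (1 + cHs d a * latticeConst d (deltaH d a - μ)) * Rψ) * Real.exp (-(μ * D)) := by
  have hρ : ∀ x y : X d, (D - min (dist x (blk n p)) D) - (D - min (dist y (blk n p)) D) ≤ dist x y :=
    lipschitz_trunc_dist (blk n p) D
  -- on the supports the weight is `e^{0} = 1`; off them the datum is `0`
  have hwt : ∀ (f : X d → ℝ) (R : ℝ) (g : X d → X d), (∀ x, |f x| ≤ R) → (∀ x, dist (g x) (blk n p) < D → f x = 0) →
      ∀ x, Real.exp (μ * (D - min (dist (g x) (blk n p)) D)) * |f x| ≤ R := by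
    intro f R g hf hfar x
    by_cases hx : dist (g x) (blk n p) < D
    · rw [hfar x hx, abs_zero, mul_zero]; exact (abs_nonneg _).trans (hf x)
    · rw [not_lt] at hx
      rw [min_eq_right hx, sub_self, mul_zero, Real.exp_zero, one_mul]; exact hf x
  have h := weighted_augInverse hd n ha hμ0 hμH hμU hρ (hwt k Rk id hk hkfar) hψ (hwt ψ Rψ (blk n) hψ hψfar) p
  have h' := abs_le_exp_neg_mul (μ := μ) (ρ := fun x => D - min (dist x (blk n p)) D) (blk n p) h
  -- at `blk p` the weight is `e^{μ(D − min(0,D))} ≥ e^{μD}`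
  have hρp : D ≤ D - min (dist (blk n p) (blk n p)) D := by
    rw [dist_self]; have := min_le_left (0 : ℝ) D; linarith
  have hexp : Real.exp (-(μ * (D - min (dist (blk n p) (blk n p)) D))) ≤ Real.exp (-(μ * D)) :=
    Real.exp_le_exp.2 (neg_le_neg (mul_le_mul_of_nonneg_left hρp hμ0))
  have hRk : 0 ≤ Rk := (abs_nonneg _).trans (hk 0)
  have hRψ : 0 ≤ Rψ := (abs_nonneg _).trans (hψ 0)
  have hCH : 0 ≤ cHs d a * latticeConst d (deltaH d a - μ) :=
    mul_nonneg (cHs_nonneg d ha) (latticeConst_nonneg d (sub_pos.2 hμH).le)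
  have hCΓ : 0 ≤ ((cG0 d * cKL d (d - 2) + cSplit d a) * Real.exp (2 * deltaU d a)
      + cFar d a * Real.exp (4 * deltaU d a) / deltaU d a ^ 2) * latticeConst d (deltaU d a / 4 - μ)
        * (1 + cHs d a * latticeConst d (deltaH d a - μ)) :=
    mul_nonneg (mul_nonneg (supConstG_nonneg d ha) (latticeConst_nonneg d (sub_pos.2 hμU).le)) (by linarith)
  have hB0 : 0 ≤ cHs d a * latticeConst d (deltaH d a - μ) * Rk
      + ((cG0 d * cKL d (d - 2) + cSplit d a) * Real.exp (2 * deltaU d a)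
          + cFar d a * Real.exp (4 * deltaU d a) / deltaU d a ^ 2) * latticeConst d (deltaU d a / 4 - μ)
            * (1 + cHs d a * latticeConst d (deltaH d a - μ)) * Rψ :=
    add_nonneg (mul_nonneg hCH hRk) (mul_nonneg hCΓ hRψ)
  exact h'.trans (mul_le_mul_of_nonneg_left hexp hB0)

end Summit.QuantumFields.BalabanUV.T4Continuum.NE7b.OneShotChartWeightedRows
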